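import Mathlib
import Summits.NavierStokesRegularity.NavierStokesRegularity.Theorems.StretchingWellBindingTypeIBridgeTools
import Summits.NavierStokesRegularity.NavierStokesRegularity.Theses.StretchingWellBinding
import HarnessLib

/-!
# `StretchingWellBinding.TypeIBridge` — enstrophy Type I at a maximal time yields a local Type-I
  singular point (item stmt-NavierStokesRegularity-10521)

**Statement.** `ν > 0`, `T > 0`, `(u, p)` a MAXIMAL classical solution on `ℝ³ × [0, T)` (no
classical extension past `T`), Leray–Hopf on `[0, T]` from a rapidly decaying datum, with the
enstrophy Type-I bound `∫ |ω(t)|² ≤ K / √(T − t)` on `[0, T)`. Then some suitable weak solution of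
the unit-viscosity system has a local Type-I singular point in the sense of Albritton–Barker 2019
(`IsLocalTypeISingularPoint r₀ z v q`: suitable in `Q(z, r₀)`, backward singular at `z`, with
`𝐈(Q(z, r₀)) < ∞`).

PROOF (the route of the item's docstring; pattern of the tree's
`SereginSverak2002.exists_zoom_typeIBound_lt_top` / `seregin_sverak_2002_of_not_localTypeISingularityExists`
with the scaled ENERGY `A` replaced by the scaled DISSIPATION `E`).
1. *A bad point.* If `u` were backward bounded at every `(T, x₀)`, the near-field/far-field bounds
   (`SereginSverak2002.nearField_bound`, `…farField_bound`) would bound `u` on `(δ, T) × ℝ³`, and the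
   bounded-continuation theorem (`hasSmoothExtensionPast_of_bounded_holds`, RRS 2016 Thm. 8.17, after a
   restart at an energy-good time) would continue `u` past `T`, contradicting maximality.
2. *The zoom.* About the bad point, the viscosity-normalising parabolic zoom `v = α u ∘ Φ`,
   `π = α² q ∘ Φ` (`Φ(s,y) = (T + βs, x₀ + Ry)`, `α = R/ν`, `β = R²/ν`, `q` Tao's gauge of the pressure)
   is a suitable weak solution in `Q(0, 1)` with the zoomed classical gradient as weak gradient
   (verbatim the tree's block).
3. *Scaled dissipation.* On every parabolic sub-ball `Q(z', r) ⊆ Q(0, 1)` the slices of the zoomed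
   gradient obey `∫ |∇v(s)|² ≤ K' / √(s₀ − s)` (`s₀ = z'.1`; whole-space div–curl estimate
   `∫ |∇u|² ≤ ∫ |curl u|²`, the enstrophy hypothesis, and `−s ≥ s₀ − s`), whence
   `E(Q(z', r)) = r⁻¹ ∫∫ |∇v|² ≤ 2K'` (time integral `∫_{s₀−r²}^{s₀} (s₀ − s)^{-1/2} ds = 2r`).
4. *Albritton–Barker Lemma 2.6*, `E`-case (`albrittonBarker2019_lemma_2_6_holds.of_cknE_le`, Seregin
   2006): `𝐈(Q(0, 1/2)) < ∞`; and the bad point makes the origin a backward singular point of `v`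
   (`SereginSverak2002.isBackwardBoundedAt_of_zoom`).

HONEST FRAMING: a bookkeeping bridge between two formulations of a HYPOTHETICAL Type-I singularity
(global enstrophy rate vs. Albritton–Barker's local class); no such singularity is asserted to
exist. Nothing here bears on the regularity problem itself.
-/

noncomputable section

set_option linter.dupNamespace false

namespace Summit.NavierStokesRegularity.NavierStokesRegularity.Theorems

open MeasureTheory Set Filter Topology Metric Function Literature.Analysis.FluidPDE
open scoped NNReal ENNReal

namespace TypeIBridge

variable {ν T : ℝ} {u : ℝ → (EuclideanSpace ℝ (Fin 3)) → (EuclideanSpace ℝ (Fin 3))} {p : ℝ → (EuclideanSpace ℝ (Fin 3)) → ℝ}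

/-! ### Steps 2–4: the zoom about a final-time point is locally Type I (dissipation case) -/

/-- **The viscosity-normalising zoom about a final-time point is locally Type I, under the
enstrophy Type-I bound.** For a classical solution on `[0, T)` (viscosity `ν > 0`), Leray–Hopf on
`[0, T]`, with `∫ |curl u(t)|² ≤ K/√(T − t)` on `[0, T)`, and any `x₀`, there are `R, α, β > 0`
(`β ≤ T`) such that the pair `v = α u ∘ Φ`, `π = α² q ∘ Φ` is a suitable weak solution of the
unit-viscosity system in `Q(0, 1)` with the zoomed classical gradient as weak gradient and
`𝐈(Q(0, 1/2)) < ⊤`: the scaled dissipation `E` is bounded on all parabolic sub-balls of `Q(0,1)`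
(slice bounds from the div–curl estimate and the enstrophy hypothesis), and the tree's
`albrittonBarker2019_lemma_2_6_holds` (E-case) bounds `A, C, D`.
[cite: AlbrittonBarker2019, Lemma 2.6 and Def. 2.1] -/
theorem exists_zoom_typeIBound_lt_top_of_enstrophy (hν : 0 < ν) (hT : 0 < T)
    (hsol : IsClassicalNSSolutionOn (Ico 0 T) ν 0 u p) (hLH : IsLerayHopfOn T ν 0 (u 0) u)
    (hens : ∃ K : ℝ, ∀ t ∈ Ico 0 T,
      ∫⁻ x, ‖curl (u t) x‖ₑ ^ 2 ≤ ENNReal.ofReal (K / Real.sqrt (T - t))) (x₀ : (EuclideanSpace ℝ (Fin 3))) :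
    ∃ R α β : ℝ, 0 < R ∧ 0 < α ∧ 0 < β ∧ β ≤ T ∧
      IsSuitableWeakSolutionInBall 1 0 (α • stPull β R T x₀ u)
        (α ^ 2 • stPull β R T x₀ fun t x => p t x - (p t 0 - normalisedPressure (u t) 0)) ∧
      HasWeakSpatialGradientOn (parabolicCylinderOpens 1 (0 : ℝ × (EuclideanSpace ℝ (Fin 3)))) (α • stPull β R T x₀ u)
        ((α * R) • stPull β R T x₀ fun t x => fderiv ℝ (u t) x) ∧
      typeIBound (parabolicCylinder (1 / 2) (0 : ℝ × (EuclideanSpace ℝ (Fin 3)))) (α • stPull β R T x₀ u)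
        (α ^ 2 • stPull β R T x₀ fun t x => p t x - (p t 0 - normalisedPressure (u t) 0))
        ((α * R) • stPull β R T x₀ fun t x => fderiv ℝ (u t) x) < ⊤ := by
  obtain ⟨K₀, hK₀⟩ := hens
  set K : ℝ := max K₀ 0 with hKdef
  have hK0 : 0 ≤ K := le_max_right _ _
  have hKs : ∀ t ∈ Ico 0 T, ∫⁻ x, ‖curl (u t) x‖ₑ ^ 2 ≤ ENNReal.ofReal (K / Real.sqrt (T - t)) :=
    fun t ht => (hK₀ t ht).trans (ENNReal.ofReal_le_ofReal
      (div_le_div_of_nonneg_right (le_max_left _ _) (Real.sqrt_nonneg _)))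
  -- scales: `R² / ν ≤ T`
  set R : ℝ := Real.sqrt (ν * T) with hR
  have hRpos : 0 < R := Real.sqrt_pos.2 (by positivity)
  set α : ℝ := R / ν with hα
  set β : ℝ := R ^ 2 / ν with hβdef
  have hαpos : 0 < α := by positivity
  have hβpos : 0 < β := by positivity
  have hβeq : β = α * R := by rw [hβdef, hα]; field_simp
  have hβT : β ≤ T := by
    have h2 : R ^ 2 = ν * T := Real.sq_sqrt (by positivity)
    rw [hβdef, div_le_iff₀ hν]; linarith
  refine ⟨R, α, β, hRpos, hαpos, hβpos, hβT, ?_⟩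
  -- the gauged pressure
  set q : ℝ → (EuclideanSpace ℝ (Fin 3)) → ℝ := fun t x => p t x - (p t 0 - normalisedPressure (u t) 0) with hq
  -- the `ν`-cylinder `(T - β, T) × B(x₀, R)` inside the slab, and its preimage `Q(0,1)`
  set PO : TopologicalSpace.Opens (ℝ × (EuclideanSpace ℝ (Fin 3))) :=
    ⟨Ioo (T - β) T ×ˢ ball x₀ R, isOpen_Ioo.prod isOpen_ball⟩ with hPO
  have hPOslab : (PO : Set (ℝ × (EuclideanSpace ℝ (Fin 3)))) ⊆ Ioo 0 T ×ˢ (univ : Set (EuclideanSpace ℝ (Fin 3))) := by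
    rintro ⟨t, x⟩ ⟨ht, -⟩
    exact ⟨⟨by linarith [ht.1], ht.2⟩, mem_univ _⟩
  have hpre1 : stPreimage β R T x₀ PO = parabolicCylinderOpens 1 (0 : ℝ × (EuclideanSpace ℝ (Fin 3))) := by
    apply TopologicalSpace.Opens.ext
    rw [coe_stPreimage]
    have h := stAffine_preimage_cylinder_eq_parabolicCylinder hν hRpos T x₀ R
    rw [div_self hRpos.ne'] at h
    exact h
  -- suitability of the zoom on `Q(0,1)` with unit viscosity
  have hsuit1 : IsSuitableWeakSolutionOn (parabolicCylinderOpens 1 (0 : ℝ × (EuclideanSpace ℝ (Fin 3)))) 1 0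
      (α • stPull β R T x₀ u) (α ^ 2 • stPull β R T x₀ q) := by
    have h0 := (SereginSverak2002.isSuitableWeakSolutionOn_gauge_of_classical hν hT hsol hLH PO
      hPOslab).stRescale hαpos hRpos hβeq T x₀
    have hvisc : α * ν / R = 1 := by rw [hα, div_mul_cancel₀ R hν.ne', div_self hRpos.ne']
    have hforce : ((α ^ 2 * R) • stPull β R T x₀ (0 : ℝ → (EuclideanSpace ℝ (Fin 3)) → (EuclideanSpace ℝ (Fin 3)))) = 0 := by
      funext s y; simp [stPull]
    rw [hvisc, hforce, hpre1] at h0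
    exact h0
  -- the zoomed classical gradient
  have hGu : HasWeakSpatialGradientOn PO u fun t x => fderiv ℝ (u t) x :=
    hasWeakSpatialGradientOn_of_contDiffOn isOpen_Ioo hPOslab
      ((SereginSverak2002.classical_Ioo hsol).smooth_velocity.of_le (by norm_cast))
  have hGv : HasWeakSpatialGradientOn (parabolicCylinderOpens 1 (0 : ℝ × (EuclideanSpace ℝ (Fin 3))))
      (α • stPull β R T x₀ u) ((α * R) • stPull β R T x₀ fun t x => fderiv ℝ (u t) x) := by
    rw [← hpre1]
    exact hGu.stRescale α hβpos hRpos T x₀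
  -- the class `IsSuitableWeakSolutionInBall 1 0`
  have hball : IsSuitableWeakSolutionInBall 1 0 (α • stPull β R T x₀ u)
      (α ^ 2 • stPull β R T x₀ q) := by
    refine ⟨hsuit1, ?_, ⟨_, hGv, ?_⟩, ?_⟩
    · -- energy class
      set CE : ENNReal := ENNReal.ofReal (2 * VectorCalculus.kineticEnergy (u 0)) with hCE
      have hphys : ∀ᵐ t ∂(volume.restrict (Ioo (T + β * (-1)) (T + β * 0))),
          ∫⁻ x in ball x₀ R, ‖u t x‖ₑ ^ 2 ≤ CE := by
        refine (ae_restrict_mem measurableSet_Ioo).mono fun t ht => ?_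
        have htI : t ∈ Icc 0 T :=
          ⟨by nlinarith [ht.1], by have := ht.2; simp at this; exact this.le⟩
        exact (setLIntegral_le_lintegral _ _).trans (SereginSverak2002.eEnergy_le hν.le hLH htI)
      have h2 := ae_sliced_setLIntegral_ball_stRescale hβpos hRpos T x₀ x₀ R (-1) 0
        (fun t x => ‖u t x‖ₑ ^ 2) hphys
      rw [finrank_euclideanSpace_fin, sub_self, smul_zero, div_self hRpos.ne'] at h2
      set C₁ : ENNReal := ‖α‖ₑ ^ 2 * (ENNReal.ofReal (R ^ 3)⁻¹ * CE) with hC₁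
      have hC₁top : C₁ ≠ ⊤ :=
        ENNReal.mul_ne_top (by simp) (ENNReal.mul_ne_top ENNReal.ofReal_ne_top ENNReal.ofReal_ne_top)
      refine ⟨C₁.toNNReal, ?_⟩
      rw [ENNReal.coe_toNNReal hC₁top]
      have hset : Ioo ((0 : ℝ × (EuclideanSpace ℝ (Fin 3))).1 - 1 ^ 2) (0 : ℝ × (EuclideanSpace ℝ (Fin 3))).1 = Ioo (-1 : ℝ) 0 := by simp
      rw [hset]
      filter_upwards [h2] with s hs
      have e : ∀ y : (EuclideanSpace ℝ (Fin 3)), ‖(α • stPull β R T x₀ u) s y‖ₑ ^ 2 =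
          ‖α‖ₑ ^ 2 * ‖u (T + β * s) (x₀ + R • y)‖ₑ ^ 2 := by
        intro y
        rw [smul_stPull_apply, enorm_smul, mul_pow]
      simp only [e]
      rw [lintegral_const_mul' _ _ (by simp)]
      exact mul_le_mul' le_rfl hs
    · -- `∫_{Q(0,1)} |∇v|² < ⊤`
      have hpre : parabolicCylinder 1 (0 : ℝ × (EuclideanSpace ℝ (Fin 3))) =
          stAffine β R T x₀ ⁻¹' (Ioo (T - (R * 1) ^ 2 / ν) T ×ˢ ball x₀ (R * 1)) := by
        rw [hβdef, stAffine_preimage_cylinder_eq_parabolicCylinder hν hRpos T x₀ (R * 1),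
          mul_div_cancel_left₀ (1 : ℝ) hRpos.ne']
        rfl
      rw [hpre, setLIntegral_frobeniusNormSq_stRescale hβpos hRpos T x₀ (α * R),
        finrank_euclideanSpace_fin]
      refine ENNReal.mul_lt_top (ENNReal.mul_lt_top ENNReal.ofReal_lt_top ENNReal.ofReal_lt_top) ?_
      refine lt_of_le_of_lt (lintegral_mono_set ?_)
        (SereginSverak2002.lintegral_slab_frobeniusNormSq_fderiv_lt_top' hsol hLH)
      rw [mul_one]
      rintro ⟨t, x⟩ ⟨ht, -⟩
      refine ⟨⟨?_, ht.2⟩, mem_univ _⟩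
      have : R ^ 2 / ν = β := rfl
      linarith [ht.1]
    · -- `π ∈ L^{3/2}(Q(0,1))`
      refine ⟨hsuit1.distributional.2.2.1.aestronglyMeasurable, ?_⟩
      have h32 : ((3 : ENNReal) / 2).toReal = 3 / 2 := by rw [ENNReal.toReal_div]; norm_num
      have h32top : (3 : ENNReal) / 2 ≠ ⊤ := (ENNReal.div_lt_top (by simp) (by simp)).ne
      rw [eLpNorm_eq_lintegral_rpow_enorm_toReal (by norm_num) h32top, h32]
      refine ENNReal.rpow_lt_top_of_nonneg (by positivity) (ne_of_lt ?_)
      have hQ1 : parabolicCylinder 1 (0 : ℝ × (EuclideanSpace ℝ (Fin 3))) = stAffine β R T x₀ ⁻¹' (PO : Set (ℝ × (EuclideanSpace ℝ (Fin 3)))) := by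
        rw [← coe_stPreimage, hpre1]; rfl
      rw [hQ1]
      show ∫⁻ z in stAffine β R T x₀ ⁻¹' (PO : Set (ℝ × (EuclideanSpace ℝ (Fin 3)))),
          ‖(α ^ 2 • stPull β R T x₀ q) z.1 z.2‖ₑ ^ (3 / 2 : ℝ) < ⊤
      rw [setLIntegral_enorm_rpow_stRescale hβpos hRpos T x₀ (α ^ 2) q _ (by norm_num)]
      refine ENNReal.mul_lt_top (ENNReal.mul_lt_top
        (ENNReal.rpow_lt_top_of_nonneg (by norm_num) enorm_ne_top) ENNReal.ofReal_lt_top) ?_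
      exact lt_of_le_of_lt (lintegral_mono_set hPOslab)
        (SereginSverak2002.lintegral_slab_gauged_pressure_lt_top hν hT hsol hLH)
  -- the scaled dissipation `E` on every parabolic sub-ball of `Q(0,1)`
  -- joint continuity of the zoomed gradient density on `(-1, 0] × ℝ³`-like regions
  have hDu : IsSmoothSpaceTimeOn (Ico 0 T) (fun t x => fderiv ℝ (u t) x) :=
    hsol.smooth_velocity.fderiv_slice (uniqueDiffOn_Ico 0 T)
  set Gv : ℝ → (EuclideanSpace ℝ (Fin 3)) → (EuclideanSpace ℝ (Fin 3)) →L[ℝ] (EuclideanSpace ℝ (Fin 3)) := (α * R) • stPull β R T x₀ fun t x => fderiv ℝ (u t) x with hGvdef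
  set K' : ℝ := (α * R) ^ 2 * (R ^ 3)⁻¹ * (Real.sqrt β)⁻¹ * K with hK'def
  have hK'0 : 0 ≤ K' := by positivity
  have hE : ∀ (r : ℝ) (z' : ℝ × (EuclideanSpace ℝ (Fin 3))), 0 < r →
      parabolicCylinder r z' ⊆ parabolicCylinder 1 (0 : ℝ × (EuclideanSpace ℝ (Fin 3))) →
      cknE r z' Gv ≤ ENNReal.ofReal (2 * K') := by
    intro r z' hr hz'
    obtain ⟨-, -, ht1, ht2, -⟩ := parabolicCylinder_subset_data hr hz'
    simp only [Prod.fst_zero, one_pow, zero_sub] at ht1 ht2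
    -- physical times of the window lie in `(0, T)`
    have hphysT : ∀ t ∈ Ioo (z'.1 - r ^ 2) z'.1, T + β * t ∈ Ioo 0 T := by
      intro t ht
      have h1 : -1 < t := by linarith [ht.1]
      have h2 : t < 0 := lt_of_lt_of_le ht.2 ht2
      have h3 : 0 < β * (t + 1) := mul_pos hβpos (by linarith)
      have h4 : β * t < 0 := mul_neg_of_pos_of_neg hβpos h2
      constructor <;> nlinarith
    refine cknE_le_of_slice_bound_at z' hr hK'0 ?_ ?_
    · -- a.e. measurability: the density is continuous on the closed sub-slab region
      have hcont : ContinuousOn (fun w : ℝ × (EuclideanSpace ℝ (Fin 3)) => ENNReal.ofReal (frobeniusNormSq (Gv w.1 w.2)))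
          (parabolicCylinder r z') := by
        have hΦ : Continuous fun w : ℝ × (EuclideanSpace ℝ (Fin 3)) => ((T + β * w.1, x₀ + R • w.2) : ℝ × (EuclideanSpace ℝ (Fin 3))) := by
          fun_prop
        have hmaps : MapsTo (fun w : ℝ × (EuclideanSpace ℝ (Fin 3)) => ((T + β * w.1, x₀ + R • w.2) : ℝ × (EuclideanSpace ℝ (Fin 3))))
            (parabolicCylinder r z') (Ico 0 T ×ˢ (univ : Set (EuclideanSpace ℝ (Fin 3)))) := by
          intro w hw
          exact ⟨Ioo_subset_Ico_self (hphysT w.1 hw.1), mem_univ _⟩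
        have h1 : ContinuousOn (fun w : ℝ × (EuclideanSpace ℝ (Fin 3)) => fderiv ℝ (u (T + β * w.1)) (x₀ + R • w.2))
            (parabolicCylinder r z') :=
          hDu.continuousOn.comp hΦ.continuousOn hmaps
        have h2 : ContinuousOn (fun w : ℝ × (EuclideanSpace ℝ (Fin 3)) => Gv w.1 w.2) (parabolicCylinder r z') := by
          refine (h1.const_smul (α * R)).congr fun w _ => ?_
          simp [hGvdef, stPull]
        have hFrc : Continuous (frobeniusNormSq : ((EuclideanSpace ℝ (Fin 3)) →L[ℝ] (EuclideanSpace ℝ (Fin 3))) → ℝ) := by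
          unfold frobeniusNormSq
          exact continuous_finsetSum _ fun i _ =>
            ((ContinuousLinearMap.apply ℝ (EuclideanSpace ℝ (Fin 3)) (stdOrthonormalBasis ℝ (EuclideanSpace ℝ (Fin 3)) i)).continuous.norm).pow 2
        exact ENNReal.continuous_ofReal.comp_continuousOn (hFrc.comp_continuousOn h2)
      exact hcont.aemeasurable (isOpen_parabolicCylinder r z').measurableSet
    · -- the slice bound
      intro t ht
      have hτ := hphysT t ht
      set τ : ℝ := T + β * t with hτdef
      -- whole-space bound for the zoomed slice
      have hslice_univ : ∫⁻ y, ENNReal.ofReal (frobeniusNormSq (Gv t y)) ≤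
          ENNReal.ofReal ((α * R) ^ 2) * ENNReal.ofReal (R ^ 3)⁻¹ *
            ENNReal.ofReal (K / Real.sqrt (T - τ)) := by
        have e : ∀ y : (EuclideanSpace ℝ (Fin 3)), ENNReal.ofReal (frobeniusNormSq (Gv t y)) =
            ENNReal.ofReal ((α * R) ^ 2) *
              ENNReal.ofReal (frobeniusNormSq (fderiv ℝ (u τ) (x₀ + R • y))) := by
          intro y
          have e1 : Gv t y = (α * R) • fderiv ℝ (u τ) (x₀ + R • y) := rfl
          rw [e1, frobeniusNormSq_smul, ENNReal.ofReal_mul (sq_nonneg _)]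
        simp_rw [e]
        rw [lintegral_const_mul' _ _ ENNReal.ofReal_ne_top,
          lintegral_comp_space_affine hRpos x₀
            (fun x => ENNReal.ofReal (frobeniusNormSq (fderiv ℝ (u τ) x))),
          finrank_euclideanSpace_fin, mul_assoc]
        gcongr
        -- div–curl and the enstrophy hypothesis
        have hC2 : ContDiff ℝ 2 (u τ) := (hsol.contDiff_velocity (Ioo_subset_Ico_self hτ)).of_le
          (by norm_cast)
        have hL2 : ∫⁻ x, ‖u τ x‖ₑ ^ 2 < ⊤ :=
          lt_of_le_of_lt (SereginSverak2002.eEnergy_le hν.le hLH ⟨hτ.1.le, hτ.2.le⟩)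
            ENNReal.ofReal_lt_top
        exact (lintegral_frobeniusNormSq_fderiv_le_lintegral_sq_norm_curl hC2
          (hsol.divFree τ (Ioo_subset_Ico_self hτ)) hL2).trans (hKs τ (Ioo_subset_Ico_self hτ))
      refine (setLIntegral_le_lintegral _ _).trans (hslice_univ.trans ?_)
      -- `K/√(T − τ) = K/√(−βt) ≤ K β^{-1/2} / √(z'.1 − t)`
      have hTτ : T - τ = β * (-t) := by rw [hτdef]; ring
      have hzt : 0 < z'.1 - t := sub_pos.2 ht.2
      have hnt : z'.1 - t ≤ -t := by linarith
      rw [← ENNReal.ofReal_mul (sq_nonneg _), ← ENNReal.ofReal_mul (by positivity)]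
      refine ENNReal.ofReal_le_ofReal ?_
      rw [hTτ, Real.sqrt_mul hβpos.le, hK'def]
      have hsq : Real.sqrt (z'.1 - t) ≤ Real.sqrt (-t) := Real.sqrt_le_sqrt hnt
      have hsz : 0 < Real.sqrt (z'.1 - t) := Real.sqrt_pos.2 hzt
      have hsβ : 0 < Real.sqrt β := Real.sqrt_pos.2 hβpos
      have hinv : (Real.sqrt (-t))⁻¹ ≤ (Real.sqrt (z'.1 - t))⁻¹ := inv_anti₀ hsz hsq
      have hC : 0 ≤ (α * R) ^ 2 * (R ^ 3)⁻¹ * (Real.sqrt β)⁻¹ * K := by positivity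
      calc (α * R) ^ 2 * (R ^ 3)⁻¹ * (K / (Real.sqrt β * Real.sqrt (-t)))
          = (α * R) ^ 2 * (R ^ 3)⁻¹ * (Real.sqrt β)⁻¹ * K * (Real.sqrt (-t))⁻¹ := by
            rw [div_eq_mul_inv, mul_inv]; ring
        _ ≤ (α * R) ^ 2 * (R ^ 3)⁻¹ * (Real.sqrt β)⁻¹ * K * (Real.sqrt (z'.1 - t))⁻¹ :=
            mul_le_mul_of_nonneg_left hinv hC
        _ = (α * R) ^ 2 * (R ^ 3)⁻¹ * (Real.sqrt β)⁻¹ * K / Real.sqrt (z'.1 - t) := by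
            rw [div_eq_mul_inv]
  exact ⟨hball, hGv, albrittonBarker2019_lemma_2_6_holds.of_cknE_le hball hGv
    (M := (2 * K').toNNReal) fun r z' hr hz' => by
      show cknE r z' Gv ≤ ENNReal.ofReal (2 * K')
      exact hE r z' hr hz'⟩

end TypeIBridge

open TypeIBridge in
/-- **Item stmt-NavierStokesRegularity-10521** (`StretchingWellBinding.TypeIBridge`): enstrophy
Type I at the maximal time of a classical Leray–Hopf solution from a rapidly decaying datum yields
a local Type-I singular point of the unit-viscosity zoom about a final-time point where `u` is not
backward bounded. [cite: AlbrittonBarker2019, Thm. 1.1, Def. 2.1 and Lemma 2.6] -/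
theorem stretchingWellBinding_typeIBridge_proof :
    Summit.NavierStokesRegularity.NavierStokesRegularity.Theses.StretchingWellBinding.TypeIBridge := by
  unfold Summit.NavierStokesRegularity.NavierStokesRegularity.Theses.StretchingWellBinding.TypeIBridge
  intro ν T hν hT u p hmax hLH _hdec hens
  obtain ⟨x₀, hx₀⟩ := exists_not_isBackwardBoundedAt hν hT hmax hLH
  obtain ⟨R, α, β, hR, hα, hβ, hβT, hball, hGv, htypeI⟩ :=
    exists_zoom_typeIBound_lt_top_of_enstrophy hν hT hmax.1 hLH hens x₀
  have hsing : IsBackwardSingularPoint (α • stPull β R T x₀ u) (0 : ℝ × EuclideanSpace ℝ (Fin 3)) := by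
    intro r hr
    by_contra hfin
    have hfin' : eLpNorm (uncurry (α • stPull β R T x₀ u)) ⊤
        (volume.restrict (parabolicCylinder (min r 1) (0 : ℝ × EuclideanSpace ℝ (Fin 3)))) < ⊤ := by
      refine lt_of_le_of_lt (eLpNorm_mono_measure _ (Measure.restrict_mono ?_ le_rfl))
        (lt_top_iff_ne_top.2 hfin)
      exact SuitableCompactness.parabolicCylinder_zero_mono (le_min hr.le zero_le_one) (min_le_left _ _)
    exact hx₀ (SereginSverak2002.isBackwardBoundedAt_of_zoom hmax.1 x₀ hR hα hβ hβT
      (lt_min hr one_pos) (min_le_right _ _) hfin')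
  refine ⟨1 / 2, 0, α • stPull β R T x₀ u,
    α ^ 2 • stPull β R T x₀ (fun t x => p t x - (p t 0 - normalisedPressure (u t) 0)),
    by norm_num, ?_, hsing, _,
    hGv.mono (SuitableCompactness.parabolicCylinderOpens_zero_mono (by norm_num) (by norm_num)),
    htypeI⟩
  exact SuitableCompactness.isSuitableWeakSolutionInBall_of_le_radius hball (by norm_num) (by norm_num)

end Summit.NavierStokesRegularity.NavierStokesRegularity.Theorems

end
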